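import Summits.ABC.StewartYu.PadicG3VbBudget
import Summits.ABC.StewartYu.PadicG3ParNF
import HarnessLib

/-!
# The `𝔑`-threaded odd-`p` record `PadicG3ParN` — budget ATOMS valid at EVERY `m` (file A of the r3 budget)

Support file (theorems only; no named facts). Cell `abc-stewartyu`, route `YuMatveevShapeRat`, crux r3 `PadicCoreOddRat`
(stmt-ABC-20503); seat p1 (record owner), for the line lead p2's `ineqPackSat_schedN_one` (STATUS 2026-08-27T19:25:51Z:
hypotheses `hKfar/hKlam/hHfar/hHlam`). The landed v2 atoms of `PadicG3VbBudget`/`PadicG3VbHalf` carry `hm : P.m = 0`;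
the N-record is ONE family for every `m` (plan R28), so the atoms are re-derived here WITHOUT a branch hypothesis, in
three currencies: the directional letter `W_LV` (`(n+1)·LgV·W_LV ≤ Zp/(64g)`), the Feldman block `HV`
(`(n+1)·LgV·HV ≤ Zp/(64g)`, landed) and the `Y₀`-load `yloadG` (`(n+1)·LgV·yloadG ≤ Zp/36`, from the Siegel branch `XE` of `XV`).
The key device (new): the depth AND the saturation index are absorbed by the ONE directional letter —
`log Ω + log K + n·log C_b − (n−1)·log g + log 24 ≤ log(LV+1)` (the box scale contains `Ω·K`), `N ≤ (2/log 2)ⁿΩ` (field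
`hNΩ`, NOT `hNW`) and `2/log 2 ≤ C_b/16` give **`ŜN·log 2 ≤ log(LV+1) + G/8 − 3n + 14`**, whence with `W + log(LV+1) + 1 ≤ W_LV`
every per-order letter of the pack is `≤ (small multiple of) W_LV + HV + G/8`.
* parent-level (`PadicG3Par`, any `m`): `log_p_le_two_G`, `log_K_le_G_add`, `log_K_ge`, `yloadG_ge`, `succ_LgV_yloadG_le`,
  `log_LV_succ_ge`, `twoDivLog_le_Cb_div`, `W_add_log_succ_le_WLV`, `succ_LgV_WLV_le`, `succ_LgV_G_le`, `succ_LgV_le_Zp`,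
  `eight_htsV_zero_le`, `sumA_le`, `sumA_mul_le`, `SdG_real_le_LgV`;
* N-level (`PadicG3ParN`): `SdN_log_le`. (Sequel `PadicG3ParNBudgetB`: the order letters, `ℓU`, `AV⁺`, `AcondV` up to `ŜN`;
  `…C`: the four inequalities; `…D`: the U-floor/headline.)

## References
* [Nesterenko2003] Yu. V. Nesterenko, LNM 1819 (2003) — §3.5 (3.23)–(3.24), §4.2 (4.26)–(4.35), §4.3 (4.44)–(4.45).
* [Yu2013] K. Yu, Acta Math. 211 (2013) — §3.1, §7.
-/

noncomputable section

open Finset Real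

namespace Summit.ABC.StewartYu

namespace PadicG3Par

variable {n : ℕ} (P : PadicG3Par n)

/-! ### Logarithms of `p` and `K` against the gain exponent `G` (any `m`) -/

/-- `log p ≤ 2G` when `½ ≤ θ₀`. [folklore] -/
theorem log_p_le_two_G (hθ : 1 / 2 ≤ P.θ₀) : Real.log P.p ≤ 2 * P.G := by
  have := P.θ₀_log_le_G; have := P.log_p_pos; nlinarith

/-- **`log K ≤ G + (1 − θ₀)·log p`** (`K = p^m K₀ ≤ p^{m+1}`, `G = (m+θ₀) log p`; every `m`). [cite: Yu2013, §7] -/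
theorem log_K_le_G_add : Real.log P.K ≤ P.G + (1 - P.θ₀) * Real.log P.p := by
  have hp := P.two_le_p
  have hK₀p : (P.K₀ : ℝ) ≤ P.p := by exact_mod_cast P.hK₀p
  have hK : (P.K : ℝ) ≤ (P.p : ℝ) ^ P.m * P.p := by
    unfold K; push_cast; exact mul_le_mul_of_nonneg_left hK₀p (by positivity)
  have hlog : Real.log P.K ≤ (P.m + 1) * Real.log P.p := by
    calc Real.log P.K ≤ Real.log ((P.p : ℝ) ^ P.m * P.p) := Real.log_le_log P.K_pos hK
      _ = (P.m + 1) * Real.log P.p := by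
          rw [Real.log_mul (by positivity) (by positivity), Real.log_pow]; ring
  have hG : P.G = (P.m + P.θ₀) * Real.log P.p := by unfold G θm; ring
  rw [hG]; nlinarith [P.log_p_pos]

/-- **`G + (1 − θ₀)·log p − log 2 ≤ log K`** when `p − 1 ≤ K₀` (`K ≥ p^m·p/2`; every `m`). [cite: Yu2013, §7] -/
theorem log_K_ge (hK₀ : (P.p : ℝ) - 1 ≤ P.K₀) : P.G + (1 - P.θ₀) * Real.log P.p - Real.log 2 ≤ Real.log P.K := by
  have hp := P.two_le_p
  have hK : (P.p : ℝ) ^ P.m * (P.p / 2) ≤ P.K := by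
    unfold K; push_cast
    exact mul_le_mul_of_nonneg_left (by linarith) (by positivity)
  have h0 : (0 : ℝ) < (P.p : ℝ) ^ P.m * (P.p / 2) := by positivity
  have hlog : (P.m + 1) * Real.log P.p - Real.log 2 ≤ Real.log P.K := by
    calc (P.m + 1) * Real.log P.p - Real.log 2 = Real.log ((P.p : ℝ) ^ P.m * (P.p / 2)) := by
          rw [Real.log_mul (by positivity) (by positivity), Real.log_pow,
            Real.log_div (by positivity) (by norm_num)]; ring
      _ ≤ Real.log P.K := Real.log_le_log h0 hK
  have hG : P.G = (P.m + P.θ₀) * Real.log P.p := by unfold G θm; ring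
  rw [hG]; nlinarith [P.log_p_pos]

/-- **`yloadG ≥ 2G + (3 − θ₀)·log p + (2n+23)·log 2 + log(n+1) + 8`** when `N_q = K`, `p − 1 ≤ K₀`
(`(ŜG+n+1) log 2 ≥ log K − log 2 + (2n+24) log 2`; every `m`). [folklore] -/
theorem yloadG_ge (hNq : P.Nq = P.K) (hK₀ : (P.p : ℝ) - 1 ≤ P.K₀) :
    2 * P.G + (3 - P.θ₀) * Real.log P.p + (2 * n + 23) * Real.log 2 + Real.log (n + 1) + 8 ≤ P.yloadG := by
  have hK := P.log_K_ge hK₀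
  have hK1 := P.one_le_K
  -- `log K < (Nat.log 2 K + 1) · log 2`
  have hlt : P.K < 2 ^ (Nat.log 2 P.K + 1) := Nat.lt_pow_succ_log_self (by norm_num) _
  have hltR : (P.K : ℝ) < 2 ^ (Nat.log 2 P.K + 1) := by exact_mod_cast hlt
  have hlogK : Real.log P.K < ((Nat.log 2 P.K : ℕ) + 1 : ℝ) * Real.log 2 := by
    have := Real.log_lt_log P.K_pos hltR
    rw [Real.log_pow] at this; push_cast at this; exact this
  -- `SdG ≥ n + 24 + Nat.log 2 K`
  have hSd : ((n + 24 + Nat.log 2 P.K : ℕ) : ℝ) ≤ P.SdG := by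
    have : n + 24 + Nat.log 2 P.K ≤ P.SdG := by unfold SdG; rw [hNq]; omega
    exact_mod_cast this
  push_cast at hSd
  have hl2 : (0 : ℝ) < Real.log 2 := Real.log_pos (by norm_num)
  unfold yloadG
  nlinarith [mul_le_mul_of_nonneg_right hSd hl2.le]

/-- `yloadG ≥ 2G + 25` (coarse form, `p ≥ 2`, `θ₀ ≤ 2`). [folklore] -/
theorem yloadG_ge' (hNq : P.Nq = P.K) (hK₀ : (P.p : ℝ) - 1 ≤ P.K₀) : 2 * P.G + 25 ≤ P.yloadG := by
  have h := P.yloadG_ge hNq hK₀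
  have hθ2 := P.hθ₀2
  have hlp := P.log_two_le_log_p
  have hl2 : (0.6931471803 : ℝ) < Real.log 2 := Real.log_two_gt_d9
  have hn1 : (1 : ℝ) ≤ n := by exact_mod_cast P.hn
  have hlogn : 0 ≤ Real.log ((n : ℝ) + 1) := Real.log_nonneg (by linarith)
  have hx : Real.log 2 ≤ (3 - P.θ₀) * Real.log P.p := by nlinarith [P.log_p_pos]
  have hy : 25 * Real.log 2 ≤ (2 * (n : ℝ) + 23) * Real.log 2 := by nlinarith
  nlinarith

/-! ### The three currencies in the unit `Zp = G·g·XV·LgV` -/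

/-- **`(n+1)·LgV·yloadG ≤ Zp/36`** (Siegel branch `XE ≤ XV` and the main branch of `LgV`; every `m`). [folklore] -/
theorem succ_LgV_yloadG_le : ((n : ℝ) + 1) * P.LgV * P.yloadG ≤ P.Zp / 36 := by
  have hXE := P.XE_le_XV
  have hmain := P.mainV_le_LgV
  have hg : 0 < P.g := lt_of_lt_of_le zero_lt_one P.one_le_g
  have hG : 0 < P.G := by linarith [P.eight_le_G]
  have hΩ := P.Ω_pos
  have hK := P.K_pos
  have hCb : (0 : ℝ) < Cb ^ n := pow_pos (by linarith [two_le_Cb]) n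
  have hden : (0 : ℝ) < Cb ^ n * P.Ω * P.K := by positivity
  have hL : (0 : ℝ) ≤ P.LgV := by positivity
  have hgn : P.g ^ n = P.g ^ (n - 1) * P.g := P.pow_g_eq
  have hgp : (0 : ℝ) < P.g ^ (n - 1) := by positivity
  -- `yloadG ≤ LgV · G · gⁿ/(24 C_bⁿ Ω K)`
  have h1 : P.yloadG ≤ P.LgV * P.G * P.g ^ n / (24 * Cb ^ n * P.Ω * P.K) := by
    rw [le_div_iff₀ (by positivity)]
    rw [div_le_iff₀ (by positivity)] at hmain
    nlinarith
  -- `(n+1) LgV · [LgV G gⁿ/(24 C_bⁿ Ω K)] = (G g/36) · XE · LgV`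
  have h2 : ((n : ℝ) + 1) * P.LgV * (P.LgV * P.G * P.g ^ n / (24 * Cb ^ n * P.Ω * P.K)) =
      (P.G * P.g / 36) * ((3 / 2) * (n + 1) * P.LgV * P.g ^ (n - 1) / (Cb ^ n * P.Ω * P.K)) * P.LgV := by
    rw [hgn]; field_simp; ring
  have h3 : ((n : ℝ) + 1) * P.LgV * P.yloadG ≤ ((n : ℝ) + 1) * P.LgV * (P.LgV * P.G * P.g ^ n / (24 * Cb ^ n * P.Ω * P.K)) :=
    mul_le_mul_of_nonneg_left h1 (by positivity)
  rw [h2] at h3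
  have h4 : (P.G * P.g / 36) * ((3 / 2) * (n + 1) * P.LgV * P.g ^ (n - 1) / (Cb ^ n * P.Ω * P.K)) * P.LgV ≤
      (P.G * P.g / 36) * P.XV * P.LgV :=
    mul_le_mul_of_nonneg_right (mul_le_mul_of_nonneg_left hXE (by positivity)) hL
  have e : (P.G * P.g / 36) * P.XV * P.LgV = P.Zp / 36 := by unfold Zp; ring
  linarith

/-- **the box scale contains `Ω·K`**: `log Ω + log K + n·log C_b − (n−1)·log g + log 24 ≤ log(LV + 1)`
(`LV + 1 > g·LgV ≥ 24 C_bⁿ Ω K (yloadG/G)/g^{n−1}`, `yloadG ≥ G`; every `m`). [folklore] -/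
theorem log_LV_succ_ge : Real.log P.Ω + Real.log P.K + n * Real.log Cb - (n - 1 : ℝ) * Real.log P.g + Real.log 24 ≤
    Real.log ((P.LV : ℝ) + 1) := by
  have hmain := P.mainV_le_LgV
  have hLV := P.LV_gt
  have hy := P.G_le_yloadG
  have hg1 := P.one_le_g
  have hg : 0 < P.g := by linarith
  have hG : 0 < P.G := by linarith [P.eight_le_G]
  have hΩ := P.Ω_pos
  have hK := P.K_pos
  have hCb0 : (0 : ℝ) < Cb := by linarith [two_le_Cb]
  have hCb : (0 : ℝ) < Cb ^ n := pow_pos hCb0 n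
  have hgn : P.g ^ n = P.g ^ (n - 1) * P.g := P.pow_g_eq
  have hgp : (0 : ℝ) < P.g ^ (n - 1) := by positivity
  have hn1 := P.hn
  -- `24 C_bⁿ Ω K / g^{n-1} ≤ g · LgV < LV + 1`
  have h1 : 24 * Cb ^ n * P.Ω * P.K / P.g ^ (n - 1) ≤ P.g * P.LgV := by
    have h2 : 24 * Cb ^ n * P.Ω * P.K * P.yloadG / (P.G * P.g ^ n) * P.g ≤ P.LgV * P.g :=
      mul_le_mul_of_nonneg_right hmain hg.le
    have h3 : 24 * Cb ^ n * P.Ω * P.K / P.g ^ (n - 1) ≤ 24 * Cb ^ n * P.Ω * P.K * P.yloadG / (P.G * P.g ^ n) * P.g := by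
      rw [hgn, div_le_iff₀ hgp]
      have e : 24 * Cb ^ n * P.Ω * P.K * P.yloadG / (P.G * (P.g ^ (n - 1) * P.g)) * P.g * P.g ^ (n - 1) =
          24 * Cb ^ n * P.Ω * P.K * (P.yloadG / P.G) := by field_simp
      rw [e]
      have hyG : 1 ≤ P.yloadG / P.G := by rw [le_div_iff₀ hG]; linarith
      have h0 : 0 ≤ 24 * Cb ^ n * P.Ω * P.K := by positivity
      nlinarith
    linarith
  have h2 : 24 * Cb ^ n * P.Ω * P.K / P.g ^ (n - 1) < (P.LV : ℝ) + 1 := by linarith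
  have h0 : 0 < 24 * Cb ^ n * P.Ω * P.K / P.g ^ (n - 1) := by positivity
  have h3 := Real.log_le_log h0 h2.le
  have e : Real.log (24 * Cb ^ n * P.Ω * P.K / P.g ^ (n - 1)) =
      Real.log 24 + n * Real.log Cb + Real.log P.Ω + Real.log P.K - (n - 1 : ℝ) * Real.log P.g := by
    rw [Real.log_div (by positivity) hgp.ne', Real.log_mul (by positivity) hK.ne',
      Real.log_mul (by positivity) hΩ.ne', Real.log_mul (by norm_num) hCb.ne', Real.log_pow, Real.log_pow]
    rw [Nat.cast_sub hn1]; push_cast; ring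
  linarith

/-- `2/log 2 ≤ C_b/16 = 2e` (as `e·log 2 ≥ 1`). [folklore] -/
theorem twoDivLog_le_Cb_div : 2 / Real.log 2 ≤ Cb / 16 := by
  unfold Cb cM
  have hl2 : (0.6931471803 : ℝ) < Real.log 2 := Real.log_two_gt_d9
  have he : (2.7182818283 : ℝ) < Real.exp 1 := Real.exp_one_gt_d9
  have hl0 : 0 < Real.log 2 := by linarith
  rw [div_le_iff₀ hl0]
  push_cast
  nlinarith

/-- **`W + log(LV+1) + 1 ≤ W_LV`**. [folklore] -/
theorem W_add_log_succ_le_WLV : P.W + Real.log ((P.LV : ℝ) + 1) + 1 ≤ P.WLV := by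
  have h := P.W_add_log_le_WLV
  have hL1 := P.one_le_LV
  have h1 : Real.log ((P.LV : ℝ) + 1) ≤ Real.log (2 * P.LV) := Real.log_le_log (by linarith) (by linarith)
  linarith

/-- **`(n+1)·LgV·W_LV ≤ Zp/(64 g)`** (directional branch of `XV`). [folklore] -/
theorem succ_LgV_WLV_le : ((n : ℝ) + 1) * P.LgV * P.WLV ≤ P.Zp / (64 * P.g) := by
  have h := P.WLV_mul_le
  have hL1 := P.one_le_LV
  have hL0 : (0 : ℝ) < P.LV := by linarith
  have hg : 0 < P.g := lt_of_lt_of_le zero_lt_one P.one_le_g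
  have hLg : (0 : ℝ) ≤ P.LgV := by positivity
  -- divide by `LV`
  have h1 : ((n : ℝ) + 1) * P.WLV ≤ P.G * P.XV / 64 := by
    have h2 : (((n : ℝ) + 1) * P.WLV) * P.LV ≤ (P.G * P.XV / 64) * P.LV := by
      have e1 : (((n : ℝ) + 1) * P.WLV) * P.LV = (n + 1) * P.LV * P.WLV := by ring
      have e2 : (P.G * P.XV / 64) * P.LV = P.G * P.XV * P.LV / 64 := by ring
      rw [e1, e2]; exact h
    exact le_of_mul_le_mul_right h2 hL0
  rw [le_div_iff₀ (by positivity)]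
  unfold Zp
  nlinarith [mul_le_mul_of_nonneg_right h1 (mul_nonneg hLg hg.le)]

/-- **`(n+1)·LgV·G ≤ Zp/(64 g)`** (`XV ≥ 64(n+1)`). [folklore] -/
theorem succ_LgV_G_le : ((n : ℝ) + 1) * P.LgV * P.G ≤ P.Zp / (64 * P.g) := by
  have hX := P.sixtyfour_le_XV'
  have hg : 0 < P.g := lt_of_lt_of_le zero_lt_one P.one_le_g
  have hG : 0 ≤ P.G := by linarith [P.eight_le_G]
  have hLg : (0 : ℝ) ≤ P.LgV := by positivity
  rw [le_div_iff₀ (by positivity)]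
  unfold Zp
  nlinarith [mul_le_mul_of_nonneg_left hX (mul_nonneg (mul_nonneg hG hLg) hg.le)]

/-- **`(n+1)·LgV ≤ Zp/(512·(n+1)·g²)`** (`G = 8(n+1)g`, `XV ≥ 64(n+1)`). [folklore] -/
theorem succ_LgV_le_Zp : ((n : ℝ) + 1) * P.LgV ≤ P.Zp / (512 * (n + 1) * P.g ^ 2) := by
  have hX := P.sixtyfour_le_XV'
  have hg : 0 < P.g := lt_of_lt_of_le zero_lt_one P.one_le_g
  have hLg : (0 : ℝ) ≤ P.LgV := by positivity
  have hGg := P.G_eq_mul_g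
  rw [le_div_iff₀ (by positivity)]
  unfold Zp; rw [hGg]
  have h0 : (0 : ℝ) ≤ (n + 1) * P.LgV * P.g ^ 2 := by positivity
  nlinarith [mul_le_mul_of_nonneg_left hX h0]

/-- **`8·htsV 0 ≤ (n/(n+1) + 1/(32(n+1)))·Zp`**, in the product form `8·(n+1)·htsV 0 ≤ (n + 1/32)·Zp`. [folklore] -/
theorem eight_htsV_zero_le : 8 * ((n : ℝ) + 1) * P.htsV 0 ≤ ((n : ℝ) + 1 / 32) * P.Zp := by
  unfold htsV Zp
  have hLV := P.LV_le_g_mul_LgV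
  have hX := P.sixtyfour_le_XV'
  have hGg := P.G_eq_mul_g
  have hg1 := P.one_le_g
  have hg : 0 < P.g := by linarith
  have hLg : (0 : ℝ) ≤ P.LgV := by positivity
  have hn0 : (0 : ℝ) ≤ n := Nat.cast_nonneg n
  simp only [pow_zero, one_mul]
  rw [hGg]
  -- `n LV (gXV+2) ≤ n g LgV (gXV + 2)`; `8(n+1)·n g LgV·gXV = n·Zp`; `16(n+1) n g LgV ≤ Zp/32` as `512 n ≤ 8(n+1)·g·XV`... use `XV ≥ 64(n+1)`
  have h1 : (n : ℝ) * P.LV * (P.g * P.XV + 2) ≤ n * (P.g * P.LgV) * (P.g * P.XV + 2) := by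
    have h0 : 0 ≤ P.g * P.XV + 2 := by positivity
    exact mul_le_mul_of_nonneg_right (mul_le_mul_of_nonneg_left hLV hn0) h0
  have h2 : 16 * ((n : ℝ) + 1) * (n * (P.g * P.LgV)) ≤ (1 / 32) * (8 * (n + 1) * P.g * (P.g * P.XV * P.LgV)) := by
    -- `16 n ≤ (1/4) g XV` since `g XV ≥ 64(n+1)`
    have hgX : 64 * ((n : ℝ) + 1) ≤ P.g * P.XV := by nlinarith
    have h0 : (0 : ℝ) ≤ (n + 1) * P.g * P.LgV := by positivity
    nlinarith [mul_le_mul_of_nonneg_left hgX h0]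
  nlinarith [h1, h2]

/-- `Σⱼ Aⱼ ≤ n·g·LgV/2` (`Aⱼ ≤ Amax`, `(2Amax+1)/g ≤ LgV`). [folklore] -/
theorem sumA_le : ∑ j, P.A j ≤ n * (P.g * P.LgV) / 2 := by
  have hA := P.Amax_div_le_LgV
  have hg : 0 < P.g := lt_of_lt_of_le zero_lt_one P.one_le_g
  have h1 : ∑ j, P.A j ≤ n * P.Amax := by
    calc ∑ j, P.A j ≤ ∑ _j : Fin n, P.Amax := Finset.sum_le_sum fun j _ => P.hAmax j
      _ = n * P.Amax := by rw [Finset.sum_const, Finset.card_univ, Fintype.card_fin, nsmul_eq_mul]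
  have h2 : 2 * P.Amax + 1 ≤ P.g * P.LgV := by rwa [div_le_iff₀' hg] at hA
  have hn0 : (0 : ℝ) ≤ n := Nat.cast_nonneg n
  nlinarith [mul_le_mul_of_nonneg_left h2 hn0]

/-- `(6n+10)·Σⱼ Aⱼ ≤ Zp/128` (and hence `8·ΣAⱼ ≤ Zp/128`). [folklore] -/
theorem sumA_mul_le : (6 * (n : ℝ) + 10) * ∑ j, P.A j ≤ P.Zp / 128 := by
  have h1 := P.sumA_le
  have h2 := P.succ_LgV_le_Zp
  have hg1 := P.one_le_g
  have hg : 0 < P.g := by linarith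
  have hZ := P.Zp_facts.1
  have hn1 : (1 : ℝ) ≤ n := by exact_mod_cast P.hn
  have hLg : (0 : ℝ) ≤ P.LgV := by positivity
  -- `(6n+10) n g LgV/2 = (3n+5) n g LgV ≤ (3n+5) g (n+1) LgV ≤ (3n+5) g Zp/(512(n+1)g²) = (3n+5) Zp/(512 (n+1) g)`
  have h3 : ((n : ℝ) + 1) * P.LgV * (512 * (n + 1) * P.g ^ 2) ≤ P.Zp := by
    rwa [le_div_iff₀ (by positivity)] at h2
  have h4 : (6 * (n : ℝ) + 10) * ∑ j, P.A j ≤ (3 * n + 5) * (n * (P.g * P.LgV)) := by nlinarith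
  -- `(3n+5) n g LgV · 128 ≤ Zp`: since `(3n+5)·128 n g ≤ 512 (n+1)² g²·`? use `(3n+5)·128 ≤ 512(n+1)` and `n g LgV ≤ (n+1) g² LgV`
  have h5 : (3 * (n : ℝ) + 5) * (n * (P.g * P.LgV)) * 128 ≤ ((n : ℝ) + 1) * P.LgV * (512 * (n + 1) * P.g ^ 2) := by
    have ha : (3 * (n : ℝ) + 5) * 128 ≤ 512 * (n + 1) := by nlinarith
    have hb : (n : ℝ) * (P.g * P.LgV) ≤ (n + 1) * P.g ^ 2 * P.LgV := by
      have hgg : P.g * P.LgV ≤ P.g ^ 2 * P.LgV := by nlinarith [mul_nonneg (sub_nonneg.mpr hg1) (mul_nonneg hg.le hLg)]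
      have hn0 : (0 : ℝ) ≤ n := by linarith
      nlinarith [mul_nonneg hg.le hLg]
    have h0 : 0 ≤ (n : ℝ) * (P.g * P.LgV) := by positivity
    nlinarith [mul_le_mul ha hb (by positivity) (by positivity)]
  rw [le_div_iff₀ (by norm_num)]
  linarith

/-- **`ŜG ≤ LgV/4 − 2`** (real form of the floor `4(ŜG+2) ≤ LgV`). [folklore] -/
theorem SdG_real_le_LgV : (P.SdG : ℝ) ≤ P.LgV / 4 - 2 := by
  have h := P.four_SdG_le_LgV
  have h' : ((4 * (P.SdG + 2) : ℕ) : ℝ) ≤ P.LgV := by exact_mod_cast h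
  push_cast at h'
  linarith

end PadicG3Par

namespace PadicG3ParN

open PadicG3Par (Cb cM cG two_le_Cb)

variable {n : ℕ} (P : PadicG3ParN n)

/-- **THE DEPTH LETTER IS PAID BY THE BOX SCALE**: `ŜN·log 2 ≤ log(LV+1) + G/8 − 3n + 14`
(`2^{ŜN} ≤ 2^{n+24}·K·N·2^{lgg}`, `N ≤ (2/log 2)ⁿΩ ≤ (C_b/16)ⁿΩ`, `log Ω + log K + n log C_b − (n−1) log g + log 24 ≤ log(LV+1)`,
`2^{lgg} < 4g`, `n·log g ≤ n(g−1) ≤ G/8 − n − 1`; every `m`). [folklore] -/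
theorem SdN_log_le : (P.SdN : ℝ) * Real.log 2 ≤ Real.log ((P.LV : ℝ) + 1) + P.G / 8 - 3 * n + 14 := by
  have h2pow := P.two_pow_SdN_le
  have hNΩ := P.hNΩ
  have hN1 := P.one_le_N
  have hbox := P.log_LV_succ_ge
  have hlgg := P.lgg_log_two_lt
  have hCb16 := PadicG3Par.twoDivLog_le_Cb_div
  have hg1 := P.one_le_g
  have hg : 0 < P.g := by linarith
  have hΩ := P.Ω_pos
  have hK := P.K_pos
  have hGg := P.G_eq_mul_g
  have hn1 : (1 : ℝ) ≤ n := by exact_mod_cast P.hn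
  have hl2 : (0.6931471803 : ℝ) < Real.log 2 := Real.log_two_gt_d9
  have hl2' : Real.log 2 < 0.6931471808 := Real.log_two_lt_d9
  have hl20 : 0 < Real.log 2 := by linarith
  have hCb0 : (0 : ℝ) < Cb := by linarith [two_le_Cb]
  -- (1) `ŜN log 2 ≤ (n+24) log 2 + log K + log N + lgg log 2`
  have h1 : (P.SdN : ℝ) * Real.log 2 ≤ (n + 24) * Real.log 2 + Real.log P.K + Real.log P.N + P.lgg * Real.log 2 := by
    have h : ((2 ^ P.SdN : ℕ) : ℝ) ≤ ((2 ^ (n + 24) * (P.K * P.N) * 2 ^ P.lgg : ℕ) : ℝ) := by exact_mod_cast h2pow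
    push_cast at h
    have hlog := Real.log_le_log (by positivity) h
    rw [Real.log_pow, Real.log_mul (by positivity) (by positivity), Real.log_mul (by positivity) (by positivity),
      Real.log_mul (by positivity) (by positivity), Real.log_pow, Real.log_pow] at hlog
    push_cast at hlog
    linarith
  -- (2) `log N ≤ n log(C_b/16) + log Ω = n log C_b − 4n log 2 + log Ω`
  have h2 : Real.log P.N ≤ n * Real.log Cb - 4 * n * Real.log 2 + Real.log P.Ω := by
    have hle : (P.N : ℝ) ≤ (Cb / 16) ^ n * P.Ω :=
      hNΩ.trans (mul_le_mul_of_nonneg_right (pow_le_pow_left₀ (by positivity) hCb16 n) hΩ.le)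
    have hlog := Real.log_le_log (by linarith) hle
    rw [Real.log_mul (by positivity) hΩ.ne', Real.log_pow, Real.log_div hCb0.ne' (by norm_num),
      show (16 : ℝ) = 2 ^ 4 by norm_num, Real.log_pow] at hlog
    push_cast at hlog
    linarith
  -- (3) `n log g ≤ n (g − 1)` and `(n+1) g = G/8`
  have hlogg : Real.log P.g ≤ P.g - 1 := Real.log_le_sub_one_of_pos hg
  have hlogg0 : 0 ≤ Real.log P.g := Real.log_nonneg hg1
  have h3 : (n : ℝ) * Real.log P.g ≤ P.G / 8 - n - 1 := by
    rw [hGg]; nlinarith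
  -- (4) numeric constants: `log 4 = 2 log 2`, `log 24 ≥ 3.17`
  have hlog4 : Real.log 4 = 2 * Real.log 2 := by
    rw [show (4 : ℝ) = 2 ^ 2 by norm_num, Real.log_pow]; push_cast; ring
  have hlog24 : (3.15 : ℝ) ≤ Real.log 24 := by
    rw [← Real.log_exp 3.15]
    refine Real.log_le_log (Real.exp_pos _) ?_
    have h := Real.exp_one_lt_d9
    have h0 := (Real.exp_pos 1).le
    have e : Real.exp 3.15 = Real.exp 1 ^ 3 * Real.exp 0.15 := by
      rw [← Real.exp_nat_mul, ← Real.exp_add]; norm_num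
    rw [e]
    have h15 : Real.exp (0.15 : ℝ) < 1 / (1 - 0.15) := Real.exp_bound_div_one_sub_of_interval' (by norm_num) (by norm_num)
    have h3 : Real.exp 1 ^ 3 ≤ (2.7182818286 : ℝ) ^ 3 := by gcongr
    have h15' : Real.exp (0.15 : ℝ) ≤ 1.18 := by
      have : (1 : ℝ) / (1 - 0.15) ≤ 1.18 := by norm_num
      linarith
    calc Real.exp 1 ^ 3 * Real.exp 0.15 ≤ (2.7182818286 : ℝ) ^ 3 * 1.18 :=
          mul_le_mul h3 h15' (Real.exp_pos _).le (by positivity)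
      _ ≤ 24 := by norm_num
  nlinarith [h1, h2, h3, hbox, hlgg, hlog4, hlog24, mul_nonneg (by linarith : (0:ℝ) ≤ n - 1) hlogg0]

end PadicG3ParN

end Summit.ABC.StewartYu
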